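import Literature.NumberTheory.Transcendental.PhilipponCriterionOfNesterenko
import Literature.NumberTheory.Transcendental.NesterenkoEliminationProp411Holds
import HarnessLib

/-!
# Philippon's criterion (LNM 1752 Ch. 14 Prop. 3.2) — the discharge `Philippon1986_criterion_holds`

`Literature/NumberTheory/Transcendental/PhilipponCriterionHolds.lean` — proofs only (no definitions,
no named facts). Discharges the named fact `Philippon1986_criterion` of `PhilipponCriterion.lean`
(Nesterenko–Philippon (eds.), LNM 1752, Ch. 14 (M. Waldschmidt), Prop. 3.2, p. 251: the rigid special
case of Philippon's criterion for algebraic independence — `θ ∈ ℂ^q`, `a ≥ 1`, integer polynomials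
`Q_{Nj}` of degree `≤ N` and height `≤ e^N`, small at `θ` (`≤ e^{-CN^a}`) and without common zero
in the ball of radius `e^{-3CN^a}` about `θ`, force `trdeg_ℚ ℚ(θ) > a − 1`) by composing

* `Philippon1986_criterion_of_prop_4_11` (`PhilipponCriterionOfNesterenko.lean`): Prop. 3.2 ⇐
  Philippon's main criterion (IHÉS 64 Thm 2.11, `Philippon1986_criterion_of_mainCriterion`) ⇐
  Nesterenko's toolkit, LNM 1752 Ch. 3 §4 (`Philippon1986_mainCriterion_of_nesterenko'`), of which
  Prop. 4.4 (`NesterenkoPhilippon2001_ch3_prop_4_4_holds`) and Prop. 4.13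
  (`NesterenkoPhilippon2001_ch3_prop_4_13_holds`) are discharged in the tree and Prop. 4.11 is the
  hypothesis;
* `NesterenkoPhilippon2001_ch3_prop_4_11_holds` (`NesterenkoEliminationProp411Holds.lean`): the
  discharge of Prop. 4.11 (Nesterenko's metric Bézout inequality, via the `u`-resultant).

This follows the printed dependency: Waldschmidt (Ch. 14, p. 251) deduces Prop. 3.2 as "a special
case of Philippon's criterion [PPh2] and chapter 8, §1", and the criterion itself rests on the
elimination-theoretic toolkit of Ch. 3 §4.

## References

* [NesterenkoPhilippon2001] Yu. V. Nesterenko, P. Philippon (eds.), *Introduction to Algebraic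
  Independence Theory*, LNM 1752, Springer 2001, Ch. 14 Prop. 3.2 (p. 251); Ch. 8 §1; Ch. 3 §4
  Prop. 4.4 (p. 38), Prop. 4.11 (pp. 40–41), Prop. 4.13 (p. 42).
* [Philippon1986Criteres] P. Philippon, *Critères pour l'indépendance algébrique*, Publ. Math.
  IHÉS 64 (1986) 5–52, Théorème 2.11 and §3.
-/

namespace Literature.NumberTheory.Transcendental

open Nesterenko

/-- **LNM 1752 Ch. 14 Prop. 3.2 (Philippon's criterion, rigid form), discharged.**
[cite: NesterenkoPhilippon2001, Ch. 14 Prop. 3.2 (p. 251)] [cite: Philippon1986Criteres, Théorème 2.11] -/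
theorem Philippon1986_criterion_holds : Philippon1986_criterion :=
  Philippon1986_criterion_of_prop_4_11 NesterenkoPhilippon2001_ch3_prop_4_11_holds

end Literature.NumberTheory.Transcendental
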